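import Mathlib
import Literature.NumberTheory.LFunctions.Zhang2022.Section4Prop22InnerEdge
import Literature.NumberTheory.LFunctions.Zhang2022.SkeletonProp22W
import Literature.NumberTheory.LFunctions.Zhang2022.TypedSection04C
import HarnessLib

/-!
# Zhang (2022), typed skeleton: the §4 deduction of Proposition 2.2 in the windowed form
# `Ded22W c₁ c′` HOLDS (kernel; DAG node `Z22:Ded22`, re-pointed by the skeleton owner)

Topic `Literature/NumberTheory/LFunctions/Zhang2022` (Landau–Siegel audit tree; verdict-neutral).
Y. Zhang, *Discrete mean estimates and the Landau–Siegel zero*, arXiv:2211.02515v1 (2022)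
[Zhang2022LandauSiegel] — **an unrefereed manuscript under adjudication**; `Lemma42`, `Lemma45C`,
`Lemma46 c₁`, `Lemma47 c₁`, `Prop22W c′` are the skeleton's CLAIM nodes, stated not asserted. The
skeleton owner's node of record for the §4 deduction (PDF p. 23, tex L1263–L1264, "Lemma 4.5 and
4.6 together imply the assertions (i) and (ii) of Proposition 2.2 … To complete the proof of the
gap assertion (iii), it now suffices to prove [Lemma 4.7]") is

`Ded22W c₁ c′ := Lemma42 → Lemma45C → Lemma46 c₁ → Lemma47 c₁ → Prop22W c′`
(`SkeletonProp22W`; `Lemma45C` = Lemma 4.5 on the closed range `1/2 + α² ≤ σ`, which the printed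
proof's Case 2 covers; `Prop22W c′ = Prop22i ∧ Prop22ii ∧ Prop22iiiW c′`, (iii) on the inner window
`|γ − 2πt₀| < 𝓛₁ + 3/2`; Lemmas 4.6–4.7 at a constant `c₁ < c′`).

* `ded22W_holds` — **`c₁ < c′ → Ded22W c₁ c′`**, kernel-checked: (i) by `re_eq_half_of_LL_eq_zero_win`
  (zeros with `β < 1/2` reflected by the functional equation, `LL_one_sub_conj_eq_zero`; then
  `1/2 + α² ≤ β < 1` contradicts `Lemma45C` and `1/2 ≤ β < 1/2 + α²` gives `β = 1/2` by Lemma 4.6),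
  (ii) = L1-t7's landed `Section4.prop22ii_of` (`TypedSection04C`: `(LL)′(ρ) = 𝒜′(ρ)F(ρ)`, `F ≠ 0`
  on `Ω₁` by Lemma 4.2), (iii) = `prop22iii_inner_of_printed c₁ … c′` (`Section4Prop22InnerEdge`);
* `prop22i_of_lemma45C_lemma46` — (i) from the PRINTED-window nodes `Lemma45C`, `Lemma46 c₁`
  (L1-t7's `Section4.prop22i_of` takes the Case-2 display `Step4u046Alpha` and the open-range
  `Lemma45` instead).

What is NOT asserted: Lemmas 4.2, 4.5 (closed range), 4.6, 4.7 (CLAIM nodes), hence not Proposition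
2.2. Nothing about Theorems 1–2 of the source; nothing here bears on the cell's verdict on (8.24).

## References

* Y. Zhang, arXiv:2211.02515v1 (2022), §2 Proposition 2.2 (PDF p. 7, tex L406–L421), §4 p. 23
  (tex L1263–L1277). [cite: Zhang2022LandauSiegel, §4 p. 23]
-/

noncomputable section

open Complex Real ComplexConjugate

namespace Literature.NumberTheory.LFunctions.Zhang2022.Skeleton

section Pointwise
variable {D : ℕ} [NeZero D] {χ : DirichletCharacter ℂ D} {x : Chr D}

/-- (i) at one `D`, one `ψ`, with the height-window as a parameter `W`: if `𝒜 ≠ 0` for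
`1/2 + α² ≤ σ < 1` and zeros `ρ` of `𝒜` with `1/2 ≤ β < 1/2 + α²` have `β = 1/2` (both on
`|t − 2πt₀| < 𝓛₁ + W`), and the zeros of `L(s,ψ)L(s,ψχ)` with `σ > 0` are symmetric under
`s ↦ 1 − s̄`, then every zero with `0 < σ < 1` in that window is on the line (the case `W = 5/2` is
`re_eq_half_of_LL_eq_zero`). [cite: Zhang2022LandauSiegel, §4 p. 23, tex L1263] -/
theorem re_eq_half_of_LL_eq_zero_win {W : ℝ}
    (h45D : ∀ s : ℂ, 1 / 2 + alpha D ^ 2 ≤ s.re → s.re < 1 →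
      |s.im - 2 * π * t0 D| < ell1 D + W → calA χ x s ≠ 0)
    (h46D : ∀ ρ : ℂ, calA χ x ρ = 0 → 1 / 2 ≤ ρ.re → ρ.re < 1 / 2 + alpha D ^ 2 →
      |ρ.im - 2 * π * t0 D| < ell1 D + W → ρ.re = 1 / 2)
    (hrefl : ∀ s : ℂ, 0 < s.re → LL χ x s = 0 → LL χ x (1 - conj s) = 0)
    {s : ℂ} (h0 : 0 < s.re) (h1 : s.re < 1) (hw : |s.im - 2 * π * t0 D| < ell1 D + W)
    (hz : LL χ x s = 0) : s.re = 1 / 2 := by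
  have key : ∀ z : ℂ, 1 / 2 ≤ z.re → z.re < 1 → |z.im - 2 * π * t0 D| < ell1 D + W →
      LL χ x z = 0 → z.re = 1 / 2 := by
    intro z hz1 hz2 hzw hzz
    have hA : calA χ x z = 0 := by
      simp only [calA, hzz, zero_div]
    by_cases hge : 1 / 2 + alpha D ^ 2 ≤ z.re
    · exact absurd hA (h45D z hge hz2 hzw)
    · exact h46D z hA hz1 (lt_of_not_ge hge) hzw
  by_cases hs : 1 / 2 ≤ s.re
  · exact key s hs h1 hw hz
  · have hre : (1 - conj s).re = 1 - s.re := by simp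
    have him : (1 - conj s).im = s.im := by simp
    have h := key (1 - conj s) (by rw [hre]; linarith) (by rw [hre]; linarith)
      (by rw [him]; exact hw) (hrefl s h0 hz)
    rw [hre] at h
    linarith

end Pointwise

/-! ## (i) and (ii) from the printed-window nodes -/

/-- **Proposition 2.2 (i) from `Lemma45C` (Lemma 4.5 on the closed range) and Lemma 4.6 (i)**, both
on the printed window `𝓛₁ + 2` = `Ω`'s: zeros with `β < 1/2` are reflected to `1 − ρ̄ ∈ Ω` by the
functional equation, `1/2 + α² ≤ β < 1` contradicts Lemma 4.5 (closed range — the seam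
`β = 1/2 + α²` included), `1/2 ≤ β < 1/2 + α²` gives `β = 1/2`.
[cite: Zhang2022LandauSiegel, §4 p. 23, tex L1263] -/
theorem prop22i_of_lemma45C_lemma46 (c₁ : ℝ) (h45 : Lemma45C) (h46 : Lemma46 c₁) : Prop22i := by
  obtain ⟨D₀, hall⟩ := h45.and h46
  refine ⟨max D₀ 3, fun D _ χ hD hq hp x hx s hs => ?_⟩
  obtain ⟨h45D, h46D⟩ := hall D χ (le_trans (le_max_left _ _) hD) hq hp
  have hD3 : 3 ≤ D := le_trans (le_max_right _ _) hD
  obtain ⟨hsΩ, hsz⟩ := hs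
  obtain ⟨hre, him⟩ := (mem_Omega_iff' s).mp hsΩ
  obtain ⟨hre1, hre2⟩ := abs_lt.mp hre
  exact re_eq_half_of_LL_eq_zero_win (W := 2) (h45D x hx)
    (fun ρ hA h1' h2' hw' => (h46D x hx ρ hA h1' h2' hw').1)
    (fun z hz0 hzz => LL_one_sub_conj_eq_zero hD3 hp x hz0 hzz) (by linarith) (by linarith) him hsz

/-! ## The node of record `Ded22W c₁ c′` HOLDS for `c₁ < c′` -/

/-- **`Ded22W c₁ c′` HOLDS for `c₁ < c′`** — the §4 deduction of Proposition 2.2 in the skeleton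
owner's windowed form: `Lemma42 → Lemma45C → Lemma46 c₁ → Lemma47 c₁ → Prop22W c′`, from
`prop22i_of_lemma45C_lemma46`, `prop22ii_of_prop22i_lemma46` and `prop22iii_inner_of_printed`
(the printed Lemmas 4.6–4.7 at `c₁` give (iii) on the inner window `𝓛₁ + 3/2` with the strict
inequality at any `c′ > c₁`). DAG node `Z22:Ded22` (re-pointed), [Z22 p.23, tex L1263–L1264].
[cite: Zhang2022LandauSiegel, §4 p. 23] -/
theorem ded22W_holds {c₁ c' : ℝ} (h : c₁ < c') : Ded22W c₁ c' := by
  intro h42 h45 h46 h47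
  have hI : Prop22i := prop22i_of_lemma45C_lemma46 c₁ h45 h46
  exact ⟨hI, Section4.prop22ii_of c₁ h42 hI h46,
    prop22iii_inner_of_printed c₁ h42 hI h46 h47 c' h⟩

end Literature.NumberTheory.LFunctions.Zhang2022.Skeleton
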